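import Summits.QuantumFields.YangMills.Theorems.BalabanUVNodesK0BgProvisoOverRange

/-!
# K0′ ∕ RECORD13 gate ROW P11 — `BgProviso` over-ranged as typed: THE WITNESS AT `N = 2` and `¬ Provisos₁₂` (kernel certificate, part 2)

Cell `pub-ymgap`, seat `pub-ymgap-dag-n21-c` (g4), `--supports stmt-QuantumFields-19902 --as helper` (K0′, ROW P11).  COUNT-NEUTRAL.
Part 1 (`…K0BgProvisoOverRange`, imported) proves that 11c's `Node00.BgProviso` AS TYPED (membership in [I]'s `U^c_j(X, α_{0,j}, α_{1,j})` for
EVERY `X ∈ 𝐃_j`, where print — [Balaban1988Convergent] (2.27) p. 259, (2.30) p. 260 — asks it for `X ⊂ Λ_j` only) FORCES every scale-`0`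
configuration within `min(cR·ε₀(g₀), εreg)` of `1` to obey `1 − Re tr W₀(∂p) < α_{0,j}(g_j)·η_j²` at every plaquette inside every localization domain
(`bgProviso_forces_firstOrder_small`, via the all-empty sequence of record, where def-R's (2.12) background IS `W₀` in the tree).

THIS FILE decides it at `N = 2` (K0′ is keyed at `N = 2`):
 §5 `exists_su2_witness` — `g = diag(z, z̄) ∈ SU(2)`, `z = (1 − 2s²) + 2is√(1 − s²)`: `‖g − 1‖_{op} ≤ 2s`, `1 − Re tr g∕2 = 2s²`; torus bookkeeping
    `shift_cover`, `shift_ne_self`, `one_lt_sitesPerDir_zero`; ★ `exists_plaq_plaqInside_domSites` (a plaquette inside a single-cube domain of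
    `𝐃_j`, cube side `≥ 2`); `exists_oneBond_cfg` (value `g` on one bond: `U(∂p) = g`, all plaquette variables within `4·dist1 g` of `1`); `two_le_side`.
 §6 ★ `not_bgProviso_of_smallRadius`: for ANY setting with `ι = ιSU 2` and ANY residual recipe, `n ≥ 1`, `M ≥ 1`, and some `0 ≤ s ≤ 1` with
    `8s < cR·ε₀(g₀)`, `8s < εreg`, `α₀(g_n)·η_n² ≤ 2s²`: `¬ BgProviso … n (regSuppOfRecord … cR) (UbgMSOfRecord …)`;
    ★ `not_provisos₁₂_of_window_smallRadius`: at ANY `θ : Stage12Params F 2` with ONE run `p`, ONE length `1 ≤ n ≤ p.K` whose history lies in the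
    window `]0, γ]` up to `n` (the guard of `Provisos₁₂.bg`), `θ.τ9.M ≥ 1` and that smallness at `(p, n)`: `¬ θ.Provisos₁₂ F 2` — through `bg` alone.
    The smallness is print's regime, not a corner: `α₀(g) = g·C₀·(log g⁻²)^{q₀}` ((2.28)), `η_n² = L^{−2n} ≤ 13^{−2n}`, against the FIXED thresholds
    `εreg`, `cR·ε₀(g₀)`.

HONEST FRAMING.  A located TYPING defect (range of `X`), certified; nothing of Bałaban's contradicted or asserted; K0′ AS WORDED («every displayed
proviso a theorem» with `bg` over all `X`) is unreachable at `N = 2` in the non-vacuous regime until `bg`'s `spaceI` conjunct is re-ranged to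
`domSites X ⊆ Λ_j(s)` (def-T's pen in `Record13`; consumers unchanged) — after which ROW P11 is [15] Thm 1 (8),(10) at def-R's objects (N07's slot).
Theorems only: 0 `def`, 0 `sorry`; one finite `T⁴` at fixed `ε`; not continuum ∕ OS ∕ mass-gap ∕ Clay.
-/

open scoped Matrix.Norms.L2Operator

namespace Summit.QuantumFields.YangMills.Theorems.K0BgProvisoOverRange

open Literature.MathematicalPhysics.QuantumFieldTheory.Balaban1983to89
open Literature.MathematicalPhysics.QuantumFieldTheory.Balaban1983to89.Node00
open Literature.MathematicalPhysics.QuantumFieldTheory.Balaban1983to89.T4Continuum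

noncomputable section


/-! ## §5  The witness at `N = 2`: an `SU(2)` diagonal bond, a plaquette inside a cube of `𝐃_n`, and `¬ BgProviso` -/

section Witness

open B15Eq112TorusCover B14DomainGeom

/-- **The `SU(2)` witness**: for `0 ≤ s ≤ 1`, `g = diag(z, z̄)` with `z = (1 − 2s²) + 2is√(1 − s²)` (`|z| = 1`) has `‖g − 1‖_{op} ≤ 2s` and
`1 − Re tr g ∕ 2 = 2s²`. [folklore] -/
theorem exists_su2_witness (s : ℝ) (hs0 : 0 ≤ s) (hs1 : s ≤ 1) : ∃ g : SU 2, dist1 g ≤ 2 * s ∧ 1 - reTr g = 2 * s ^ 2 := by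
  set c : ℝ := Real.sqrt (1 - s ^ 2) with hc
  have hc2 : c ^ 2 = 1 - s ^ 2 := by rw [hc, Real.sq_sqrt (by nlinarith)]
  set z : ℂ := ⟨1 - 2 * s ^ 2, 2 * s * c⟩ with hz
  have hnsq : Complex.normSq z = 1 := by
    rw [hz, Complex.normSq_mk]; nlinarith [hc2]
  have hzz : z * (starRingEnd ℂ) z = 1 := by
    rw [Complex.mul_conj, hnsq]; simp
  have hzz' : (starRingEnd ℂ) z * z = 1 := by rw [mul_comm, hzz]
  set v : Fin 2 → ℂ := ![z, (starRingEnd ℂ) z] with hv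
  set A : Matrix (Fin 2) (Fin 2) ℂ := Matrix.diagonal v with hA
  have hstar : ∀ i, v i * star (v i) = 1 := by
    intro i; fin_cases i
    · simpa [hv] using hzz
    · simpa [hv] using hzz'
  have hunit : A ∈ Matrix.unitaryGroup (Fin 2) ℂ := by
    rw [Matrix.mem_unitaryGroup_iff, hA, Matrix.star_eq_conjTranspose, Matrix.diagonal_conjTranspose, Matrix.diagonal_mul_diagonal,
      ← Matrix.diagonal_one]
    congr 1
    funext i
    exact hstar i
  have hdet : A.det = 1 := by
    rw [hA, Matrix.det_diagonal, Fin.prod_univ_two]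
    simpa [hv] using hzz
  refine ⟨⟨A, Matrix.mem_specialUnitaryGroup_iff.mpr ⟨hunit, hdet⟩⟩, ?_, ?_⟩
  · -- `‖A − 1‖ ≤ 2s`
    show ‖A - 1‖ ≤ 2 * s
    have hsub : A - 1 = Matrix.diagonal (v - 1) := by
      rw [hA, ← Matrix.diagonal_one, Matrix.diagonal_sub]; rfl
    rw [hsub, Matrix.l2_opNorm_diagonal]
    have hz1 : ‖z - 1‖ = 2 * s := by
      have hre : (z - 1).re = -(2 * s ^ 2) := by simp [hz]
      have him : (z - 1).im = 2 * s * c := by simp [hz]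
      rw [Complex.norm_def, Complex.normSq_apply, hre, him]
      have h4 : -(2 * s ^ 2) * -(2 * s ^ 2) + 2 * s * c * (2 * s * c) = (2 * s) ^ 2 := by nlinarith [hc2]
      rw [h4, Real.sqrt_sq (by linarith)]
    refine (pi_norm_le_iff_of_nonneg (by linarith)).mpr fun i => ?_
    fin_cases i
    · simpa [hv] using hz1.le
    · have : ‖(starRingEnd ℂ) z - 1‖ = 2 * s := by
        rw [← hz1, ← Complex.norm_conj (z - 1), map_sub, map_one]
      simpa [hv] using this.le
  · -- `1 − Re tr A ∕ 2 = 2s²`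
    show 1 - UnitaryModel.nReTr A = 2 * s ^ 2
    simp only [UnitaryModel.nReTr, hA, Matrix.trace_diagonal, hv, Fin.sum_univ_two, Matrix.cons_val_zero, Matrix.cons_val_one,
      Fintype.card_fin]
    simp [hz]

variable {P : Params}

/-- `π(z) + e_μ = π(z + e_μ)` on the torus (bookkeeping of the cover). [cite: Balaban1987RG1, (0.1) p.251 (bookkeeping)] -/
theorem shift_cover (z : Pt P.d) (μ : Fin P.d) : (cover P z).shift μ = cover P (Function.update z μ (z μ + 1)) := by
  funext i
  simp only [Site.shift, cover_apply, Function.update_apply]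
  split_ifs with h
  · subst h; push_cast; rfl
  · rfl

/-- A shifted site differs from the site (every torus of the family has period `2L^{m+K−j} ≥ 2`). [cite: Balaban1987RG1, (0.1) p.251 (bookkeeping)] -/
theorem shift_ne_self {j : ℕ} (hper : 1 < P.sitesPerDir j) (x : Site P j) (μ : Fin P.d) : x.shift μ ≠ x := by
  intro h
  have h1 := congrFun h μ
  simp only [Site.shift, Function.update_self] at h1
  have h2 : (1 : ZMod (P.sitesPerDir j)) = 0 :=
    calc (1 : ZMod (P.sitesPerDir j)) = x μ + 1 - x μ := (add_sub_cancel_left _ _).symm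
      _ = 0 := by rw [h1, sub_self]
  exact absurd (ZMod.one_eq_zero_iff.mp h2) (by omega)

/-- The period of every torus `T^{(j)}`, `j ≤ m + K`, exceeds `1`. [cite: Balaban1987RG1, (0.1) p.251 (bookkeeping)] -/
theorem one_lt_sitesPerDir_zero (P : Params) : 1 < P.sitesPerDir 0 := by
  unfold Params.sitesPerDir
  have := Nat.one_le_pow (P.m + P.K - 0) P.L P.L_pos
  omega

/-- **A plaquette inside a cube of `𝐃_j`**: for cube side `≥ 2` (and `d ≥ 2`) the plaquette at the corner `π(0)` of the cube of index `0` in the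
directions `0 < 1` lies inside that single-cube localization domain. [cite: Balaban1987RG1, p.257 (the cubes π_j; bookkeeping)] -/
theorem exists_plaq_plaqInside_domSites (hd : 2 ≤ P.d) (M j : ℕ) (hs : 2 ≤ B14.Eq213MaximalDomains.side P.L M j) :
    ∃ (X : (Sect2.domSys P M j).Dom) (p : Plaq P 0), p ∈ plaqInside (Sect2.domSites P M j X) ∧ p.src = cover P 0 ∧
      p.μ = ⟨0, by omega⟩ ∧ p.ν = ⟨1, by omega⟩ := by
  set sd := B14.Eq213MaximalDomains.side P.L M j with hsd
  refine ⟨Sect2.cubeDom P M j 0, ⟨cover P 0, ⟨0, by omega⟩, ⟨1, by omega⟩, by simp [Fin.lt_def]⟩, ?_, rfl, rfl, rfl⟩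
  rw [Sect2.domSites_cubeDom]
  have hlift : Sect2.liftIdx P (0 : TreeLengthTorus.TPt P.d (Sect2.domCount P M j)) = 0 := by
    funext i; simp [Sect2.liftIdx]
  rw [hlift]
  -- membership of an integer point with coordinates in `{0, 1}` in the window `[0, sd − 1]^d`
  have hmem : ∀ z : Pt P.d, (∀ i, z i = 0 ∨ z i = 1) → cover P z ∈ cubeEnl P sd 0 0 := by
    intro z hz
    refine ⟨z, fun i => ?_, rfl⟩
    have hsd2 : (2 : ℤ) ≤ sd := by exact_mod_cast hs
    rcases hz i with h | h <;> simp [h] <;> omega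
  have h0 : ∀ i : Fin P.d, (0 : Pt P.d) i = 0 ∨ (0 : Pt P.d) i = 1 := fun i => Or.inl rfl
  have hupd : ∀ (z : Pt P.d) (μ : Fin P.d), (∀ i, z i = 0 ∨ z i = 1) → z μ = 0 →
      ∀ i, Function.update z μ (z μ + 1) i = 0 ∨ Function.update z μ (z μ + 1) i = 1 := by
    intro z μ hz hμ i
    by_cases h : i = μ
    · subst h; right; simp [hμ]
    · rw [Function.update_of_ne h]; exact hz i
  refine ⟨hmem 0 h0, ?_, ?_, ?_⟩
  · show (cover P 0).shift _ ∈ _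
    rw [shift_cover]
    exact hmem _ (hupd 0 _ h0 rfl)
  · show (cover P 0).shift _ ∈ _
    rw [shift_cover]
    exact hmem _ (hupd 0 _ h0 rfl)
  · show ((cover P 0).shift _).shift _ ∈ _
    rw [shift_cover, shift_cover]
    refine hmem _ (hupd _ _ (hupd 0 _ h0 rfl) ?_)
    rw [Function.update_of_ne (by simp [Fin.ext_iff])]
    rfl

/-- **The one-bond configuration**: value `g` on the first bond of `p`, `1` elsewhere; its plaquette variable at `p` is `g` and every plaquette
variable is within `4·dist1 g` of `1`. [cite: Balaban1985Averaging, (3) p.18 (bookkeeping)] -/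
theorem exists_oneBond_cfg {G : Type*} [GaugeGroup G] (hper : 1 < P.sitesPerDir 0) (g : G) (p : Plaq P 0) :
    ∃ U : GaugeField P 0 G, GaugeField.plaqHol U p = g ∧ ∀ q, dist1 (GaugeField.plaqHol U q) ≤ 4 * dist1 g := by
  classical
  refine ⟨fun b => if b = ⟨p.src, p.μ⟩ then g else 1, ?_, fun q => ?_⟩
  · have hne : p.μ ≠ p.ν := fun h => absurd p.hμν (by rw [h]; exact lt_irrefl _)
    have h2 : (⟨p.src.shift p.μ, p.ν⟩ : PBond P 0) ≠ ⟨p.src, p.μ⟩ := fun h => hne.symm (congrArg PBond.dir h)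
    have h3 : (⟨p.src.shift p.ν, p.μ⟩ : PBond P 0) ≠ ⟨p.src, p.μ⟩ := fun h =>
      shift_ne_self hper p.src p.ν (congrArg PBond.src h)
    have h4 : (⟨p.src, p.ν⟩ : PBond P 0) ≠ ⟨p.src, p.μ⟩ := fun h => hne.symm (congrArg PBond.dir h)
    rw [GaugeField.plaqHol, if_pos rfl, if_neg h2, if_neg h3, if_neg h4]
    simp only [mul_one, inv_one]
  · have hb : ∀ b : PBond P 0, dist1 ((fun b => if b = ⟨p.src, p.μ⟩ then g else 1 : GaugeField P 0 G) b) ≤ dist1 g := by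
      intro b
      by_cases h : b = ⟨p.src, p.μ⟩
      · simp [h]
      · simp only [if_neg h, GaugeGroup.dist1_one]; exact GaugeGroup.dist1_nonneg g
    simp only [GaugeField.plaqHol]
    calc dist1 (_ * _ * _⁻¹ * _⁻¹) ≤ dist1 (_ * _ * _⁻¹) + dist1 _⁻¹ := GaugeGroup.dist1_mul_le _ _
      _ ≤ dist1 (_ * _) + dist1 _⁻¹ + dist1 _⁻¹ := by gcongr; exact GaugeGroup.dist1_mul_le _ _
      _ ≤ dist1 _ + dist1 _ + dist1 _⁻¹ + dist1 _⁻¹ := by gcongr; exact GaugeGroup.dist1_mul_le _ _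
      _ ≤ dist1 g + dist1 g + dist1 g + dist1 g := by
          rw [GaugeGroup.dist1_inv, GaugeGroup.dist1_inv]; gcongr <;> exact hb _
      _ = 4 * dist1 g := by ring

end Witness

/-! ## §6  `¬ BgProviso` at `N = 2` under the smallness of the scale-`n` radius; the Stage-12 corollary -/

section NotBg

variable {F : T4Family}

/-- The cubes of `𝐃_j` have side `L^j·M ≥ 2` fine sites for `j ≥ 1`, `M ≥ 1` (`L > 11`). [cite: Balaban1987RG1, p.257 (bookkeeping)] -/
theorem two_le_side (K : ℕ) {M j : ℕ} (hM : 1 ≤ M) (hj : 1 ≤ j) : 2 ≤ B14.Eq213MaximalDomains.side (F.P K).L M j := by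
  unfold B14.Eq213MaximalDomains.side
  have hL : 2 ≤ (F.P K).L := by have := (F.P K).hL.2; omega
  calc 2 ≤ (F.P K).L ^ 1 * 1 := by simpa using hL
    _ ≤ (F.P K).L ^ j * M := Nat.mul_le_mul (Nat.pow_le_pow_right (by omega) hj) hM

/-- **`¬ BgProviso` AT `N = 2` (the located over-range, decided).**  For ANY setting with the embedding of record and ANY residual recipe: if the
scale-`n` radius is small against the retained∕class thresholds — some `0 ≤ s ≤ 1` with `8s < cR·ε₀(g₀)`, `8s < εreg` and
`α₀(g_n)·η_n² ≤ 2s²` — then 11c's background proviso over def-R's objects FAILS as typed (`n ≥ 1`, `M ≥ 1`): the one-bond `SU(2)`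
configuration of §5 is retained and `εreg`-small, its (2.12) background along the all-empty sequence is itself (§3), and §4's forced bound
`1 − Re tr g∕2 < α₀(g_n)·η_n² ≤ 2s² = 1 − Re tr g∕2` is absurd.  Print's sentence (membership for `X ⊂ Λ_j` only) is NOT contradicted.
[cite: Balaban1988Convergent, (2.27)–(2.28) p.259] -/
theorem not_bgProviso_of_smallRadius {K : ℕ} (S : Sect2.Setting (MatA 2) (SU 2)) (hι : S.ι = ιSU 2) (Rz : Sect2.Residual (F.P K) (MatA 2))
    {ν : Stage7Numerics} {M : ℕ} {g : ℕ → ℝ} {n : ℕ} {cR : ℝ} (hn : 1 ≤ n) (hM : 1 ≤ M) (s : ℝ) (hs0 : 0 ≤ s) (hs1 : s ≤ 1)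
    (hsupp : 8 * s < cR * epsOfRecord ν g 0) (hreg : 8 * s < ν.εreg) (hα : S.lf.alpha0 (S.flow.g n) * (F.P K).eta n ^ 2 ≤ 2 * s ^ 2) :
    ¬ BgProviso F 2 K S Rz M n (regSuppOfRecord F 2 ν M g K n cR) (UbgMSOfRecord F 2 ν M g K n) := by
  intro h
  obtain ⟨g₀, hg₁, hg₂⟩ := exists_su2_witness s hs0 hs1
  obtain ⟨X, p, hp, -, -, -⟩ := exists_plaq_plaqInside_domSites (P := F.P K) (by simp) M n (two_le_side K hM hn)
  obtain ⟨U, hUp, hUq⟩ := exists_oneBond_cfg (one_lt_sitesPerDir_zero (F.P K)) g₀ p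
  have hregU : PlaqSmall ν.εreg U := fun q => by linarith [hUq q]
  have hsuppU : PlaqSmall (cR * epsOfRecord ν g 0) U := fun q => by linarith [hUq q]
  have hlt := bgProviso_forces_firstOrder_small S hι Rz hn h U hregU hsuppU hn le_rfl X p hp
  rw [hUp, hg₂] at hlt
  linarith

/-- **THE STAGE-12 COROLLARY (K0′'s `bg` field, N = 2).**  At ANY `θ : Stage12Params F 2` admitting ONE run `p` and ONE length `1 ≤ n ≤ K` whose history
lies in the window `]0, γ]` up to `n` (the guard of `Provisos₁₂.bg`), with `M ≥ 1` and the scale-`n` radius small as above at `(p, n)`, the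
displayed provisos `Provisos₁₂` FAIL — through the `bg` field alone, read at def-R's `UbgMSOfRecord` (`UbgOfRecord₁₂ … (n'+1)`) on `regSuppOfRecord`
along the all-empty sequence.  The repair is a RANGE restriction of `bg`'s `spaceI` conjunct to print's `X ⊂ Λ_j(s)`, not an estimate.
[cite: Balaban1988Convergent, (2.27)–(2.28) p.259, (2.7) p.255] -/
theorem not_provisos₁₂_of_window_smallRadius (θ : Stage12Params F 2) (p : B12.RunParams) {n : ℕ} (hn : 1 ≤ n) (hnK : n ≤ p.K)
    (hw : Step.InInterval θ.γ n (gOfRecord₁₀ F 2 θ.toStage9Params p)) (hM : 1 ≤ θ.τ9.M) (s : ℝ) (hs0 : 0 ≤ s) (hs1 : s ≤ 1)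
    (hsupp : 8 * s < θ.s2.cR * epsOfRecord θ.ν (gOfRecord₁₀ F 2 θ.toStage9Params p) 0) (hreg : 8 * s < θ.ν.εreg)
    (hα : (lfOfRecord₁₂ F 2 θ).alpha0 (gOfRecord₁₀ F 2 θ.toStage9Params p n) * (F.P p.K).eta n ^ 2 ≤ 2 * s ^ 2) :
    ¬ θ.Provisos₁₂ F 2 := by
  intro hP
  obtain ⟨n', rfl⟩ : ∃ n', n = n' + 1 := ⟨n - 1, by omega⟩
  have hbg : BgProviso F 2 p.K (settingOfRecord₁₂ F 2 θ p) (θ.Rz p.K) θ.τ9.M (n' + 1)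
      (regSuppOfRecord F 2 θ.ν θ.τ9.M (gOfRecord₁₀ F 2 θ.toStage9Params p) p.K (n' + 1) θ.s2.cR)
      (UbgMSOfRecord F 2 θ.ν θ.τ9.M (gOfRecord₁₀ F 2 θ.toStage9Params p) p.K (n' + 1)) := hP.bg p (n' + 1) hnK hw
  exact not_bgProviso_of_smallRadius (settingOfRecord₁₂ F 2 θ p) rfl (θ.Rz p.K) hn hM s hs0 hs1 hsupp hreg hα hbg

end NotBg

end

end Summit.QuantumFields.YangMills.Theorems.K0BgProvisoOverRange
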